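import Literature.MathematicalPhysics.QuantumFieldTheory.Balaban1983to89.B1Eq324BenfattoKernelSect5TupleClustersDecay
import Literature.MathematicalPhysics.QuantumFieldTheory.Balaban1983to89.B1Eq324BenfattoSect5FreeStepCrossBound
import HarnessLib

/-!
# `Balaban1983to89.B1Eq324BenfattoKernelSect5FreeStepCross` — [BenfattoEtAl1978] §5 p. 159 «Collecting all the errors made in this process»:
# the CROSS colourings of one pavement step UNDER THE CENTRED GAUSSIAN FIELD `𝒩(0,K)` OF A GENERAL KERNEL — the structural extensive bound
# (`…Sect5FreeStepCross`) AND its closed form (`…Sect5FreeStepCrossBound`) with the covariance decay and the diagonal DISPLAYED AS ROWS — PROVED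
# (free side of the class road, `K_ref = K_Λ`; reads row 4 `…KernelSect5TupleClustersDecay`)

statement-level skeleton of published theorems with citation tags; proofs where landed; nothing here is a claim about the
Yang–Mills mass gap

WHY THIS MODULE (cell `pub-ymgap`, seat `dag-n08-b` gen 12; node N08 [Balaban1985UV3]; the [BenfattoEtAl1978] source chain behind the (α)-row
`h324c`; FREE SIDE of the class port, `N08-PORT-MAP-CLUSTER-SIDE.md` §3 / `N08-CLASS-TOOLKIT.md` §6 «K_REF OF RECORD»).  `…Sect5FreeStepCross` and
`…Sect5FreeStepCrossBound` (this seat, gen 5) bound the CROSS colourings left by the free-side telescope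
(`…Sect5FreeStep.sum_truncatedExp_sub_eq_telescope`, kernel edition `…KernelSect5FreeStep`, p610935) under PRINT'S reference field `P̂₀ = P0 d α β`
(= `condField d α β ∅ 0`), reading it ONLY through Appendix D with the decay split over the slots
(`…TupleClustersDecay.abs_ursellOf_tupleSums_condField_le_prod_decayMass` at `Γ = ∅`).  On the class road the free-side identification runs under
the CENTRED Gaussian field `gaussianFieldOfKernel K` of the class covariance `K = K_Λ` (design note «K_REF OF RECORD», n08-b g11; frame
covariance `K ↦ K(·+τ,·+τ)` between steps), so the same two statements are needed with `P̂₀ ↦ gaussianFieldOfKernel K` and the free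
field's inputs displayed as ROWS: R0 `hK : IsPosSemidefKernel K`, R1 `hdiag : ∀ y, K y y ≤ c₀` (integrability), R2
`hdec : ∀ x y, |K x y| ≤ K₀·exp(−(δ₀·ℓ¹(x,y)))` read at `0 < δ ≤ δ₀` (`K₀ ≥ 1`; the one decay row of rows 3/4/5).  This file is that edition:
the SAME proofs with `abs_ursellOf_tupleSums_condField_le_prod_decayMass ↦ …KernelSect5TupleClustersDecay.abs_ursellOf_tupleSums_kernel_le_prod_decayMass`
(row 4 §3, the centred face) and `max(1, C₀₀) ↦ K₀`; the colouring combinatorics (`…FreeCumulants.abs_sum_cross_le_sum_anchored`,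
`…FreeStepCross.sum_anchored_prod_le`), the masses (`…FreeStepCrossMasses`) and the corridor geometry (`…Sect5Boxes`, `…LegGeometry` §1,
`…Eq524.card_shrink_le`) are measure-free and consumed BY NAME (the closed form's four private real-algebra steps are private in the concrete
module and are therefore repeated here verbatim).

DICTIONARY.  `𝓔^T_0` ↦ `ursellOf` of the moments `∂(gaussianFieldOfKernel K)`; palette `Option (↥B × Bool)`, classes `cls`, CROSS / anchored filters,
`W_m(c)`, `M_u`, `M_u^far`, `c₂ = δ/(2(k+1))`, `c = ϰ/2 − (δ/2)D²√d` exactly as in the two concrete modules; `K₀` (row R2) in place of `max(1, C₀₀)`.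
The concrete modules are the instance `K := freeCov d α β` (`P0 = gaussianFieldOfKernel`-free massive field; R2 from `…AppendixC2.freeCov_le_self_mul_pow_l1`
at `δ₀ = log((2d+α²)/2d)`).

WHAT IS PROVED (theorems only; no definition, no named fact, no `sorry`; axioms standard).
* §1 `abs_ursellOf_kernel_le_of_anchored` — one colouring using `(m,true)`: `|𝓔^T_{𝒩(0,K)}(f)| ≤ 2^{(k+1)D}2^{2^{(k+1)D}}K₀^{(k+1)D}·Π_j W_m(f j)`;
  ★ `abs_cross_kernel_le_sum_anchor` — `|CROSS_{k+1}| ≤ 2^{(k+1)D}2^{2^{(k+1)D}}K₀^{(k+1)D}·Σ_m (k+1)k·W_m(m,true)·W^far_m·(Σ_c W_m(c))^{k−1}`.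
* §2 ★★ **`abs_cross_kernel_le_closed`** — `|CROSS_{k+1}| ≤ 2^{(k+1)D}2^{2^{(k+1)D}}K₀^{(k+1)D}·|B|·((k+1)k·(M_u·(M_u^far·M_u^{k−1})))` for any palette
  with print's four properties (deep tuples meet `□′∖Γ₄`; rest tuples inside `Γ₁`; box classes inside their box; classes pairwise disjoint).

HONEST SCOPE / NOT HERE.  (i) Rows DISPLAYED, not discharged (at `K = K_Λ`: J1 `…KernelOfPrecision.kernel_self_le` / `abs_kernel_le_exp`, or
`…ClassAppendixC.inv_apply_self_pos_le` / `abs_inv_apply_le_exp`, with the class distance compared to `ℓ¹` — the instantiation row's business);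
(ii) the palette properties for print's classes (`…Sect5CrossPalette`, seat n08-c — measure-free, reused AS IS by a class assembler), the `W₂₉`
within-box twin and the assembly are NOT here; (iii) free side of an UNCOMMISSIONED port (plan g81 (II), START-LIST v11 §n08): nothing is chained to it
here; no generalised Basic Lemma is stated; nothing of [Balaban1985UV3] (41)/(47)/(5) is asserted; count-neutral for N08; nothing about d = 4, the
continuum, OS axioms, a mass gap or the Clay problem.
-/

open MeasureTheory ProbabilityTheory Finset
open scoped BigOperators Nat NNReal

namespace Literature.MathematicalPhysics.QuantumFieldTheory.Balaban1983to89.B1Eq324BenfattoKernelSect5FreeStepCross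

open _root_.MeasureTheory _root_.ProbabilityTheory
open Literature.Probability.LatticeModels (ursellOf)
open Literature.MathematicalPhysics.QuantumFieldTheory
open Literature.MathematicalPhysics.QuantumFieldTheory.Balaban1983to89.B1Eq324BenfattoLemma
open Literature.MathematicalPhysics.QuantumFieldTheory.Balaban1983to89.B1Eq324BenfattoSect5Boxes
open Literature.MathematicalPhysics.QuantumFieldTheory.Balaban1983to89.B1Eq324BenfattoSect5Eq511 (term)
open Literature.MathematicalPhysics.QuantumFieldTheory.Balaban1983to89.B1Eq324BenfattoSect5Eq524 (card_shrink_le)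
open Literature.MathematicalPhysics.QuantumFieldTheory.Balaban1983to89.B1Eq324BenfattoSect5LegGeometry
  (le_l1_of_mem_shrink_of_not_mem_shrink le_l1_of_mem_shrink_of_not_mem_box)
open Literature.MathematicalPhysics.QuantumFieldTheory.Balaban1983to89.B1Eq324BenfattoSect5FreeCumulants (abs_sum_cross_le_sum_anchored)
open Literature.MathematicalPhysics.QuantumFieldTheory.Balaban1983to89.B1Eq324BenfattoSect5FreeStepCross (sum_anchored_prod_le)
open Literature.MathematicalPhysics.QuantumFieldTheory.Balaban1983to89.B1Eq324BenfattoSect5FreeStepCrossMasses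
  (decayWeightedMass_le decayWeightedMass_le_of_far sum_classSum_eq_classSum_biUnion)
open Literature.MathematicalPhysics.QuantumFieldTheory.Balaban1983to89.B1Eq324BenfattoKernelSect5TupleClustersDecay
  (abs_ursellOf_tupleSums_kernel_le_prod_decayMass)

variable {d : ℕ}

section Generic

variable {s D : ℕ} {ϰ : ℝ} {a : Coef d} {Jr : Finset (B1Eq324BenfattoLemma.Site d)}

/-- One class: `…FreeStepCrossMasses.decayWeightedMass_le` with `|R_A| ≤ L^d`. [cite: BenfattoEtAl1978, §5 p.159] -/
private theorem oneClass_le {δ c₂ A Ld : ℝ} (hres : 0 < ϰ / 2 - δ / 2 * ((D : ℝ) ^ 2 * Real.sqrt d)) (hc₂ : 0 < c₂) (hA0 : 0 ≤ A)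
    (hA : ∀ (p : ℕ) (Δ : Fin p → B1Eq324BenfattoLemma.Site d) (n : Fin p → ℕ), |a p Δ n| ≤ A)
    (cls : (p : ℕ) → Finset (Fin p → Jr)) (RA : Finset (B1Eq324BenfattoLemma.Site d)) (hRA : (RA.card : ℝ) ≤ Ld)
    (ρ : B1Eq324BenfattoLemma.Site d → ℝ) (hρ : ∀ y ∈ Jr, ∃ x ∈ RA, (∑ j, |((x j : ℝ) - (y j : ℝ))|) ≤ ρ y) :
    ∑ p ∈ Finset.Icc 1 s, ∑ Δ ∈ cls p, ∑ n ∈ admissible p D,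
        |a p (fun i => (Δ i : B1Eq324BenfattoLemma.Site d)) n| *
          Real.exp (-(ϰ / 2) * connLength fun i => (Δ i : B1Eq324BenfattoLemma.Site d)) *
          (Real.exp (δ / 2 * ((D : ℝ) ^ 2 * (Real.sqrt d * connLength (fun i => (Δ i : B1Eq324BenfattoLemma.Site d)) + d))) *
            Real.exp (-(c₂ * ρ (if h : 0 < p then (Δ ⟨0, h⟩ : B1Eq324BenfattoLemma.Site d) else 0)))) ≤
      A * Real.exp (δ / 2 * ((D : ℝ) ^ 2 * d)) * (Ld * (2 / (1 - Real.exp (-(c₂ / Real.sqrt d))) * Real.exp (c₂ / Real.sqrt d)) ^ d) *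
        ∑ p ∈ Finset.Icc 1 s, ((admissible p D).card : ℝ) *
          ((2 / (1 - Real.exp (-((ϰ / 2 - δ / 2 * ((D : ℝ) ^ 2 * Real.sqrt d)) / (p : ℕ) / Real.sqrt d))) *
            Real.exp ((ϰ / 2 - δ / 2 * ((D : ℝ) ^ 2 * Real.sqrt d)) / (p : ℕ) / Real.sqrt d)) ^ d) ^ (p - 1) := by
  refine (decayWeightedMass_le (s := s) (D := D) (ϰ := ϰ) (a := a) (δ := δ) hres hc₂ hA0 hA cls RA ρ hρ).trans ?_
  have hKnn : ∀ t : ℝ, 0 ≤ t → 0 ≤ 2 / (1 - Real.exp (-t)) := fun t ht =>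
    div_nonneg zero_le_two (by rw [sub_nonneg, Real.exp_le_one_iff, neg_nonpos]; exact ht)
  have hK0 : 0 ≤ (2 / (1 - Real.exp (-(c₂ / Real.sqrt d))) * Real.exp (c₂ / Real.sqrt d)) ^ d := pow_nonneg (mul_nonneg (hKnn _ (div_nonneg hc₂.le (Real.sqrt_nonneg _))) (Real.exp_pos _).le) _
  have hS0 : 0 ≤ ∑ p ∈ Finset.Icc 1 s, ((admissible p D).card : ℝ) *
          ((2 / (1 - Real.exp (-((ϰ / 2 - δ / 2 * ((D : ℝ) ^ 2 * Real.sqrt d)) / (p : ℕ) / Real.sqrt d))) *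
            Real.exp ((ϰ / 2 - δ / 2 * ((D : ℝ) ^ 2 * Real.sqrt d)) / (p : ℕ) / Real.sqrt d)) ^ d) ^ (p - 1) :=
    Finset.sum_nonneg fun p _ => mul_nonneg (Nat.cast_nonneg _) (pow_nonneg (pow_nonneg (mul_nonneg
      (hKnn _ (div_nonneg (div_nonneg hres.le (Nat.cast_nonneg _)) (Real.sqrt_nonneg _))) (Real.exp_pos _).le) _) _)
  exact mul_le_mul_of_nonneg_right (mul_le_mul_of_nonneg_left (mul_le_mul_of_nonneg_right hRA hK0) (by positivity)) hS0

/-- A far family of pairwise disjoint classes (anchors at `ρ ≥ r₀`): one class by `sum_classSum_eq_classSum_biUnion`, then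
`…FreeStepCrossMasses.decayWeightedMass_le_of_far`. [cite: BenfattoEtAl1978, §5 p.159] -/
private theorem family_far_le {P : Type*} [DecidableEq P] {δ c₂ A Ld r₀ : ℝ} (hres : 0 < ϰ / 2 - δ / 2 * ((D : ℝ) ^ 2 * Real.sqrt d))
    (hc₂ : 0 < c₂) (hA0 : 0 ≤ A) (hA : ∀ (p : ℕ) (Δ : Fin p → B1Eq324BenfattoLemma.Site d) (n : Fin p → ℕ), |a p Δ n| ≤ A)
    (Sc : Finset P) (clsF : P → (p : ℕ) → Finset (Fin p → Jr))
    (hdisj : ∀ p, ∀ c₁ ∈ Sc, ∀ c₂' ∈ Sc, c₁ ≠ c₂' → Disjoint (clsF c₁ p) (clsF c₂' p))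
    (RA : Finset (B1Eq324BenfattoLemma.Site d)) (hRA : (RA.card : ℝ) ≤ Ld)
    (ρ : B1Eq324BenfattoLemma.Site d → ℝ) (hρ : ∀ y ∈ Jr, ∃ x ∈ RA, (∑ j, |((x j : ℝ) - (y j : ℝ))|) ≤ ρ y)
    (hfar : ∀ c ∈ Sc, ∀ p (hp : p ∈ Finset.Icc 1 s), ∀ Δ ∈ clsF c p,
      r₀ ≤ ρ (Δ ⟨0, (Finset.mem_Icc.1 hp).1⟩ : B1Eq324BenfattoLemma.Site d)) :
    ∑ c ∈ Sc, ∑ p ∈ Finset.Icc 1 s, ∑ Δ ∈ clsF c p, ∑ n ∈ admissible p D,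
        |a p (fun i => (Δ i : B1Eq324BenfattoLemma.Site d)) n| *
          Real.exp (-(ϰ / 2) * connLength fun i => (Δ i : B1Eq324BenfattoLemma.Site d)) *
          (Real.exp (δ / 2 * ((D : ℝ) ^ 2 * (Real.sqrt d * connLength (fun i => (Δ i : B1Eq324BenfattoLemma.Site d)) + d))) *
            Real.exp (-(c₂ * ρ (if h : 0 < p then (Δ ⟨0, h⟩ : B1Eq324BenfattoLemma.Site d) else 0)))) ≤
      A * Real.exp (δ / 2 * ((D : ℝ) ^ 2 * d)) * Real.exp (-(c₂ / 2 * r₀)) * (Ld * (2 / (1 - Real.exp (-(c₂ / 2 / Real.sqrt d))) * Real.exp (c₂ / 2 / Real.sqrt d)) ^ d) *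
        ∑ p ∈ Finset.Icc 1 s, ((admissible p D).card : ℝ) *
          ((2 / (1 - Real.exp (-((ϰ / 2 - δ / 2 * ((D : ℝ) ^ 2 * Real.sqrt d)) / (p : ℕ) / Real.sqrt d))) *
            Real.exp ((ϰ / 2 - δ / 2 * ((D : ℝ) ^ 2 * Real.sqrt d)) / (p : ℕ) / Real.sqrt d)) ^ d) ^ (p - 1) := by
  classical
  rw [sum_classSum_eq_classSum_biUnion (s := s) (D := D) Sc clsF hdisj]
  refine (decayWeightedMass_le_of_far (s := s) (D := D) (ϰ := ϰ) (a := a) (δ := δ) hres hc₂ hA0 hA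
    (fun p => Sc.biUnion fun c => clsF c p) RA ρ hρ (r₀ := r₀) (fun p hp Δ hΔ => ?_)).trans ?_
  · obtain ⟨c, hc, hΔc⟩ := Finset.mem_biUnion.1 hΔ
    exact hfar c hc p hp Δ hΔc
  have hKnn : ∀ t : ℝ, 0 ≤ t → 0 ≤ 2 / (1 - Real.exp (-t)) := fun t ht =>
    div_nonneg zero_le_two (by rw [sub_nonneg, Real.exp_le_one_iff, neg_nonpos]; exact ht)
  have hK0 : 0 ≤ (2 / (1 - Real.exp (-(c₂ / 2 / Real.sqrt d))) * Real.exp (c₂ / 2 / Real.sqrt d)) ^ d :=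
    pow_nonneg (mul_nonneg (hKnn _ (div_nonneg (half_pos hc₂).le (Real.sqrt_nonneg _))) (Real.exp_pos _).le) _
  have hS0 : 0 ≤ ∑ p ∈ Finset.Icc 1 s, ((admissible p D).card : ℝ) *
          ((2 / (1 - Real.exp (-((ϰ / 2 - δ / 2 * ((D : ℝ) ^ 2 * Real.sqrt d)) / (p : ℕ) / Real.sqrt d))) *
            Real.exp ((ϰ / 2 - δ / 2 * ((D : ℝ) ^ 2 * Real.sqrt d)) / (p : ℕ) / Real.sqrt d)) ^ d) ^ (p - 1) :=
    Finset.sum_nonneg fun p _ => mul_nonneg (Nat.cast_nonneg _) (pow_nonneg (pow_nonneg (mul_nonneg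
      (hKnn _ (div_nonneg (div_nonneg hres.le (Nat.cast_nonneg _)) (Real.sqrt_nonneg _))) (Real.exp_pos _).le) _) _)
  exact mul_le_mul_of_nonneg_right (mul_le_mul_of_nonneg_left (mul_le_mul_of_nonneg_right hRA hK0) (by positivity)) hS0

/-- All classes of a pairwise disjoint family. [cite: BenfattoEtAl1978, §5 p.159] -/
private theorem family_all_le {P : Type*} [Fintype P] [DecidableEq P] {δ c₂ A Ld : ℝ}
    (hres : 0 < ϰ / 2 - δ / 2 * ((D : ℝ) ^ 2 * Real.sqrt d))
    (hc₂ : 0 < c₂) (hA0 : 0 ≤ A) (hA : ∀ (p : ℕ) (Δ : Fin p → B1Eq324BenfattoLemma.Site d) (n : Fin p → ℕ), |a p Δ n| ≤ A)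
    (clsF : P → (p : ℕ) → Finset (Fin p → Jr)) (hdisj : ∀ p c₁ c₂', c₁ ≠ c₂' → Disjoint (clsF c₁ p) (clsF c₂' p))
    (RA : Finset (B1Eq324BenfattoLemma.Site d)) (hRA : (RA.card : ℝ) ≤ Ld)
    (ρ : B1Eq324BenfattoLemma.Site d → ℝ) (hρ : ∀ y ∈ Jr, ∃ x ∈ RA, (∑ j, |((x j : ℝ) - (y j : ℝ))|) ≤ ρ y) :
    ∑ c, ∑ p ∈ Finset.Icc 1 s, ∑ Δ ∈ clsF c p, ∑ n ∈ admissible p D,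
        |a p (fun i => (Δ i : B1Eq324BenfattoLemma.Site d)) n| *
          Real.exp (-(ϰ / 2) * connLength fun i => (Δ i : B1Eq324BenfattoLemma.Site d)) *
          (Real.exp (δ / 2 * ((D : ℝ) ^ 2 * (Real.sqrt d * connLength (fun i => (Δ i : B1Eq324BenfattoLemma.Site d)) + d))) *
            Real.exp (-(c₂ * ρ (if h : 0 < p then (Δ ⟨0, h⟩ : B1Eq324BenfattoLemma.Site d) else 0)))) ≤
      A * Real.exp (δ / 2 * ((D : ℝ) ^ 2 * d)) * (Ld * (2 / (1 - Real.exp (-(c₂ / Real.sqrt d))) * Real.exp (c₂ / Real.sqrt d)) ^ d) *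
        ∑ p ∈ Finset.Icc 1 s, ((admissible p D).card : ℝ) *
          ((2 / (1 - Real.exp (-((ϰ / 2 - δ / 2 * ((D : ℝ) ^ 2 * Real.sqrt d)) / (p : ℕ) / Real.sqrt d))) *
            Real.exp ((ϰ / 2 - δ / 2 * ((D : ℝ) ^ 2 * Real.sqrt d)) / (p : ℕ) / Real.sqrt d)) ^ d) ^ (p - 1) := by
  classical
  rw [sum_classSum_eq_classSum_biUnion (s := s) (D := D) (Finset.univ : Finset P) clsF
    (fun p c₁ _ c₂' _ hne => hdisj p c₁ c₂' hne)]
  exact oneClass_le hres hc₂ hA0 hA _ RA hRA ρ hρ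

/-- The real-algebra assembly of the three mass bounds. [folklore] -/
private theorem crossAssemble {kk Wt Wf Wa Mu Muf : ℝ} {e : ℕ} (hkk : 0 ≤ kk) (hWf : 0 ≤ Wf) (hWa : 0 ≤ Wa)
    (hMu : 0 ≤ Mu) (h1 : Wt ≤ Mu) (h2 : Wf ≤ Muf) (h3 : Wa ≤ Mu) :
    kk * (Wt * Wf * Wa ^ e) ≤ kk * (Mu * (Muf * Mu ^ e)) := by
  refine mul_le_mul_of_nonneg_left ?_ hkk
  calc Wt * Wf * Wa ^ e ≤ Mu * Muf * Mu ^ e :=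
        mul_le_mul (mul_le_mul h1 h2 hWf hMu) (pow_le_pow_left₀ hWa h3 e) (pow_nonneg hWa e) (mul_nonneg hMu (hWf.trans h2))
    _ = Mu * (Muf * Mu ^ e) := by ring

end Generic

section Cross

variable {K : B1Eq324BenfattoLemma.Site d → B1Eq324BenfattoLemma.Site d → ℝ}
variable {s D : ℕ} {κ : ℝ} {a : Coef d} {J : Finset (B1Eq324BenfattoLemma.Site d)} {L w v : ℕ}
  {B : Finset (B1Eq324BenfattoLemma.Site d)}

/-! ## §1  The CROSS colourings under `𝒩(0,K)`: one anchored colouring and the structural extensive bound -/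

/-- **ONE ANCHORED COLOURING UNDER THE CENTRED KERNEL FIELD** (Appendix D with the decay distributed over the slots, row 4 §3): for a colouring `f`
of `k+1` slots with a slot painted `(m, true)` — the deep class of box `m`, every tuple of which meets `shrink L m (2w+v)` — and rows R0 `hK`, R1 `hdiag`,
R2 `hdec` (`K₀ ≥ 1`, `0 ≤ δ ≤ δ₀`), `|𝓔^T_{𝒩(0,K)}(f)| ≤ 2^{(k+1)D}·2^{2^{(k+1)D}}·K₀^{(k+1)D}·Π_j W_m(f j)`.  The concrete
`…FreeStepCross.abs_ursellOf_le_of_anchored` is the instance `K := freeCov d α β`. [cite: BenfattoEtAl1978, Appendix D p.166 and §5 p.159] -/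
theorem abs_ursellOf_kernel_le_of_anchored (hK : IsPosSemidefKernel K) {c₀ : ℝ≥0} (hdiag : ∀ y, K y y ≤ c₀)
    {K₀ δ₀ : ℝ} (hK₀ : 1 ≤ K₀)
    (hdec : ∀ x y : B1Eq324BenfattoLemma.Site d, |K x y| ≤ K₀ * Real.exp (-(δ₀ * ∑ jj, |((x jj : ℝ) - (y jj : ℝ))|)))
    (cls : Option (↥B × Bool) → (p : ℕ) → Finset (Fin p → J))
    (hdeep : ∀ m : ↥B, ∀ p ∈ Finset.Icc 1 s, ∀ Δ ∈ cls (some (m, true)) p,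
      ∃ i, (Δ i : B1Eq324BenfattoLemma.Site d) ∈ shrink L (m : B1Eq324BenfattoLemma.Site d) (2 * w + v))
    {δ : ℝ} (hδ : 0 ≤ δ) (hδle : δ ≤ δ₀)
    (ρ : ↥B → B1Eq324BenfattoLemma.Site d → ℝ)
    (hρ : ∀ m : ↥B, ∀ x ∈ shrink L (m : B1Eq324BenfattoLemma.Site d) (2 * w + v), ∀ y,
      ρ m y ≤ ∑ j, |((x j : ℝ) - (y j : ℝ))|)
    {k : ℕ} (m : ↥B) {f : Fin (k + 1) → Option (↥B × Bool)} (hf : ∃ j, f j = some (m, true)) :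
    |ursellOf (fun P : Finset (Fin (k + 1)) => ∫ z, ∏ j ∈ P,
        (∑ p ∈ Finset.Icc 1 s, ∑ Δ ∈ cls (f j) p, ∑ n ∈ admissible p D, term κ a z p Δ n) ∂(gaussianFieldOfKernel K)) univ| ≤
      2 ^ ((k + 1) * D) * 2 ^ 2 ^ ((k + 1) * D) * K₀ ^ ((k + 1) * D) *
        ∏ j, ∑ p ∈ Finset.Icc 1 s, ∑ Δ ∈ cls (f j) p, ∑ n ∈ admissible p D,
          |a p (fun i => (Δ i : B1Eq324BenfattoLemma.Site d)) n| *
            Real.exp (-(κ / 2) * connLength fun i => (Δ i : B1Eq324BenfattoLemma.Site d)) *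
            (Real.exp (δ / 2 * ((D : ℝ) ^ 2 * (Real.sqrt d * connLength (fun i => (Δ i : B1Eq324BenfattoLemma.Site d)) + d))) *
              Real.exp (-(δ / (2 * ((k + 1 : ℕ) : ℝ)) *
                ρ m (if h : 0 < p then (Δ ⟨0, h⟩ : B1Eq324BenfattoLemma.Site d) else (0 : B1Eq324BenfattoLemma.Site d))))) := by
  obtain ⟨j₁, hj₁⟩ := hf
  have h := abs_ursellOf_tupleSums_kernel_le_prod_decayMass (σ := Fin (k + 1)) (s := s) (D := D) (ϰ := κ) (a := a)
    hK hdiag (fun j => cls (f j)) hK₀ hdec hδ hδle j₁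
    (shrink L (m : B1Eq324BenfattoLemma.Site d) (2 * w + v) : Set (B1Eq324BenfattoLemma.Site d))
    (fun p hp Δ hΔ => by
      rw [hj₁] at hΔ
      obtain ⟨i, hi⟩ := hdeep m p hp Δ hΔ
      exact ⟨i, Finset.mem_coe.2 hi⟩)
    (ρ m) (fun x hx y => hρ m x (Finset.mem_coe.1 hx) y)
  rw [Fintype.card_fin] at h
  exact h

/-- **THE CROSS COLOURINGS OF ONE PAVEMENT STEP UNDER THE CENTRED KERNEL FIELD, EXTENSIVE IN THE BOXES** (structural form): with the palette classes
`cls`, the deep classes meeting `shrink L m (2w+v)`, rows R0/R1/R2, and the anchored decay-weighted masses `W_m(c)`,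
`|CROSS_{k+1}| ≤ 2^{(k+1)D}·2^{2^{(k+1)D}}·K₀^{(k+1)D}·Σ_m (k+1)k·W_m(m,true)·W^far_m·(Σ_c W_m(c))^{k−1}`
(`…FreeCumulants.abs_sum_cross_le_sum_anchored`, `abs_ursellOf_kernel_le_of_anchored`, `…FreeStepCross.sum_anchored_prod_le`).  The concrete
`…FreeStepCross.abs_cross_le_sum_anchor` is the instance `K := freeCov d α β`. [cite: BenfattoEtAl1978, §5 p.159 and Appendix D p.166] -/
theorem abs_cross_kernel_le_sum_anchor (hK : IsPosSemidefKernel K) {c₀ : ℝ≥0} (hdiag : ∀ y, K y y ≤ c₀)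
    {K₀ δ₀ : ℝ} (hK₀ : 1 ≤ K₀)
    (hdec : ∀ x y : B1Eq324BenfattoLemma.Site d, |K x y| ≤ K₀ * Real.exp (-(δ₀ * ∑ jj, |((x jj : ℝ) - (y jj : ℝ))|)))
    (cls : Option (↥B × Bool) → (p : ℕ) → Finset (Fin p → J))
    (hdeep : ∀ m : ↥B, ∀ p ∈ Finset.Icc 1 s, ∀ Δ ∈ cls (some (m, true)) p,
      ∃ i, (Δ i : B1Eq324BenfattoLemma.Site d) ∈ shrink L (m : B1Eq324BenfattoLemma.Site d) (2 * w + v))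
    {δ : ℝ} (hδ : 0 ≤ δ) (hδle : δ ≤ δ₀)
    (ρ : ↥B → B1Eq324BenfattoLemma.Site d → ℝ)
    (hρ : ∀ m : ↥B, ∀ x ∈ shrink L (m : B1Eq324BenfattoLemma.Site d) (2 * w + v), ∀ y,
      ρ m y ≤ ∑ j, |((x j : ℝ) - (y j : ℝ))|) (k : ℕ) :
    let W : ↥B → Option (↥B × Bool) → ℝ := fun m c => ∑ p ∈ Finset.Icc 1 s, ∑ Δ ∈ cls c p, ∑ n ∈ admissible p D,
          |a p (fun i => (Δ i : B1Eq324BenfattoLemma.Site d)) n| *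
            Real.exp (-(κ / 2) * connLength fun i => (Δ i : B1Eq324BenfattoLemma.Site d)) *
            (Real.exp (δ / 2 * ((D : ℝ) ^ 2 * (Real.sqrt d * connLength (fun i => (Δ i : B1Eq324BenfattoLemma.Site d)) + d))) *
              Real.exp (-(δ / (2 * ((k + 1 : ℕ) : ℝ)) *
                ρ m (if h : 0 < p then (Δ ⟨0, h⟩ : B1Eq324BenfattoLemma.Site d) else (0 : B1Eq324BenfattoLemma.Site d)))))
    |∑ f ∈ univ.filter (fun f : Fin (k + 1) → Option (↥B × Bool) =>
          (∃ j m, f j = some (m, true)) ∧ ¬∃ m, ∀ j, f j = some (m, false) ∨ f j = some (m, true)),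
        ursellOf (fun P : Finset (Fin (k + 1)) => ∫ z, ∏ j ∈ P,
          (∑ p ∈ Finset.Icc 1 s, ∑ Δ ∈ cls (f j) p, ∑ n ∈ admissible p D, term κ a z p Δ n) ∂(gaussianFieldOfKernel K)) univ| ≤
      2 ^ ((k + 1) * D) * 2 ^ 2 ^ ((k + 1) * D) * K₀ ^ ((k + 1) * D) *
        ∑ m, (((k + 1 : ℕ) : ℝ) * (k : ℝ) * (W m (some (m, true)) *
          (∑ c ∈ (univ.erase (some (m, false))).erase (some (m, true)), W m c) * (∑ c, W m c) ^ (k - 1))) := by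
  intro W
  set C : ℝ := 2 ^ ((k + 1) * D) * 2 ^ 2 ^ ((k + 1) * D) * K₀ ^ ((k + 1) * D) with hC
  have hC0 : 0 ≤ C := by
    have : 0 ≤ K₀ := zero_le_one.trans hK₀
    positivity
  have hW0 : ∀ m c, 0 ≤ W m c := fun m c =>
    Finset.sum_nonneg fun p _ => Finset.sum_nonneg fun Δ _ => Finset.sum_nonneg fun n _ =>
      mul_nonneg (mul_nonneg (abs_nonneg _) (Real.exp_pos _).le) (mul_nonneg (Real.exp_pos _).le (Real.exp_pos _).le)
  refine (abs_sum_cross_le_sum_anchored k _).trans ?_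
  rw [Finset.mul_sum]
  refine Finset.sum_le_sum fun m _ => ?_
  -- bound term by term on the anchored filter, then count with the two pinned slots
  have hterm : ∀ f ∈ univ.filter (fun f : Fin (k + 1) → Option (↥B × Bool) =>
        (∃ j, f j = some (m, true)) ∧ ∃ j, ¬(f j = some (m, false) ∨ f j = some (m, true))),
      |ursellOf (fun P : Finset (Fin (k + 1)) => ∫ z, ∏ j ∈ P,
          (∑ p ∈ Finset.Icc 1 s, ∑ Δ ∈ cls (f j) p, ∑ n ∈ admissible p D, term κ a z p Δ n) ∂(gaussianFieldOfKernel K)) univ| ≤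
        C * ∏ j, W m (f j) := fun f hf =>
    abs_ursellOf_kernel_le_of_anchored hK hdiag hK₀ hdec cls hdeep hδ hδle ρ hρ m (Finset.mem_filter.1 hf).2.1
  refine (Finset.sum_le_sum hterm).trans ?_
  rw [← Finset.mul_sum]
  exact mul_le_mul_of_nonneg_left (sum_anchored_prod_le (W m) (hW0 m) m) hC0

/-! ## §2  The CROSS colourings under `𝒩(0,K)` in closed form -/

/-- **THE CROSS COLOURINGS UNDER THE CENTRED KERNEL FIELD IN CLOSED FORM** — for any palette with print's four properties (deep tuples meet
`□′_m∖Γ₄(□_m) = shrink L m (2w+v)`; rest tuples inside `Γ₁ = corridors L w B`; box classes inside their box; classes pairwise disjoint), rows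
R0 `hK`, R1 `hdiag`, R2 `hdec` (`K₀ ≥ 1`, `0 < δ ≤ δ₀`), `|A^n_Δ| ≤ A` and `ϰ/2 > (δ/2)D²√d`:
`|CROSS_{k+1}| ≤ 2^{(k+1)D}2^{2^{(k+1)D}}K₀^{(k+1)D}·|B|·((k+1)k·(M_u·(M_u^far·M_u^{k−1})))`, `M_u^far` carrying `e^{−(δ/(4(k+1)))(w+v+1)}`
(`abs_cross_kernel_le_sum_anchor` + `…FreeStepCrossMasses` + the corridor geometry, word for word as in the concrete module).  The concrete
`…FreeStepCrossBound.abs_cross_le_closed` is the instance `K := freeCov d α β`. [cite: BenfattoEtAl1978, §5 p.159, Appendix D p.166] -/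
theorem abs_cross_kernel_le_closed (hK : IsPosSemidefKernel K) {c₀ : ℝ≥0} (hdiag : ∀ y, K y y ≤ c₀)
    {K₀ δ₀ : ℝ} (hK₀ : 1 ≤ K₀)
    (hdec : ∀ x y : B1Eq324BenfattoLemma.Site d, |K x y| ≤ K₀ * Real.exp (-(δ₀ * ∑ jj, |((x jj : ℝ) - (y jj : ℝ))|)))
    (hL : 0 < L) {δ A : ℝ}
    (hres : 0 < κ / 2 - δ / 2 * ((D : ℝ) ^ 2 * Real.sqrt d)) (hδ : 0 < δ) (hδle : δ ≤ δ₀)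
    (hA0 : 0 ≤ A) (hA : ∀ (p : ℕ) (Δ : Fin p → B1Eq324BenfattoLemma.Site d) (n : Fin p → ℕ), |a p Δ n| ≤ A)
    (hne : ∀ m : ↥B, (shrink L (m : B1Eq324BenfattoLemma.Site d) (2 * w + v)).Nonempty)
    (cls : Option (↥B × Bool) → (p : ℕ) → Finset (Fin p → J))
    (hdeep : ∀ m : ↥B, ∀ p ∈ Finset.Icc 1 s, ∀ Δ ∈ cls (some (m, true)) p,
      ∃ i, (Δ i : B1Eq324BenfattoLemma.Site d) ∈ shrink L (m : B1Eq324BenfattoLemma.Site d) (2 * w + v))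
    (hnone : ∀ p, ∀ Δ ∈ cls none p, ∀ i, (Δ i : B1Eq324BenfattoLemma.Site d) ∈ corridors L w B)
    (hbox : ∀ (m : ↥B) (bb : Bool) p, ∀ Δ ∈ cls (some (m, bb)) p, ∀ i,
      (Δ i : B1Eq324BenfattoLemma.Site d) ∈ box L (m : B1Eq324BenfattoLemma.Site d))
    (hdisj : ∀ p c₁ c₂, c₁ ≠ c₂ → Disjoint (cls c₁ p) (cls c₂ p)) (k : ℕ) :
    |∑ f ∈ univ.filter (fun f : Fin (k + 1) → Option (↥B × Bool) =>
          (∃ j m, f j = some (m, true)) ∧ ¬∃ m, ∀ j, f j = some (m, false) ∨ f j = some (m, true)),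
        ursellOf (fun P : Finset (Fin (k + 1)) => ∫ z, ∏ j ∈ P,
          (∑ p ∈ Finset.Icc 1 s, ∑ Δ ∈ cls (f j) p, ∑ n ∈ admissible p D, term κ a z p Δ n) ∂(gaussianFieldOfKernel K)) univ| ≤
      2 ^ ((k + 1) * D) * 2 ^ 2 ^ ((k + 1) * D) * K₀ ^ ((k + 1) * D) *
        (B.card * (((k + 1 : ℕ) : ℝ) * (k : ℝ) *
          ((A * Real.exp (δ / 2 * ((D : ℝ) ^ 2 * d)) * ((L : ℝ) ^ d * (2 / (1 - Real.exp (-(δ / (2 * ((k + 1 : ℕ) : ℝ)) / Real.sqrt d))) * Real.exp (δ / (2 * ((k + 1 : ℕ) : ℝ)) / Real.sqrt d)) ^ d) *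
              ∑ p ∈ Finset.Icc 1 s, ((admissible p D).card : ℝ) *
                ((2 / (1 - Real.exp (-((κ / 2 - δ / 2 * ((D : ℝ) ^ 2 * Real.sqrt d)) / (p : ℕ) / Real.sqrt d))) *
                  Real.exp ((κ / 2 - δ / 2 * ((D : ℝ) ^ 2 * Real.sqrt d)) / (p : ℕ) / Real.sqrt d)) ^ d) ^ (p - 1)) *
            ((A * Real.exp (δ / 2 * ((D : ℝ) ^ 2 * d)) * Real.exp (-(δ / (2 * ((k + 1 : ℕ) : ℝ)) / 2 * ((w : ℝ) + v + 1))) * ((L : ℝ) ^ d * (2 / (1 - Real.exp (-(δ / (2 * ((k + 1 : ℕ) : ℝ)) / 2 / Real.sqrt d))) * Real.exp (δ / (2 * ((k + 1 : ℕ) : ℝ)) / 2 / Real.sqrt d)) ^ d) *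
              ∑ p ∈ Finset.Icc 1 s, ((admissible p D).card : ℝ) *
                ((2 / (1 - Real.exp (-((κ / 2 - δ / 2 * ((D : ℝ) ^ 2 * Real.sqrt d)) / (p : ℕ) / Real.sqrt d))) *
                  Real.exp ((κ / 2 - δ / 2 * ((D : ℝ) ^ 2 * Real.sqrt d)) / (p : ℕ) / Real.sqrt d)) ^ d) ^ (p - 1)) *
             (A * Real.exp (δ / 2 * ((D : ℝ) ^ 2 * d)) * ((L : ℝ) ^ d * (2 / (1 - Real.exp (-(δ / (2 * ((k + 1 : ℕ) : ℝ)) / Real.sqrt d))) * Real.exp (δ / (2 * ((k + 1 : ℕ) : ℝ)) / Real.sqrt d)) ^ d) *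
              ∑ p ∈ Finset.Icc 1 s, ((admissible p D).card : ℝ) *
                ((2 / (1 - Real.exp (-((κ / 2 - δ / 2 * ((D : ℝ) ^ 2 * Real.sqrt d)) / (p : ℕ) / Real.sqrt d))) *
                  Real.exp ((κ / 2 - δ / 2 * ((D : ℝ) ^ 2 * Real.sqrt d)) / (p : ℕ) / Real.sqrt d)) ^ d) ^ (p - 1)) ^ (k - 1))))) := by
  classical
  -- the anchor length: ℓ¹-distance to the deep region, realised by a minimiser (no lattice structure on ℝ needed)
  have hmin : ∀ (m : ↥B) (y : B1Eq324BenfattoLemma.Site d), ∃ x ∈ shrink L (m : B1Eq324BenfattoLemma.Site d) (2 * w + v),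
      ∀ x' ∈ shrink L (m : B1Eq324BenfattoLemma.Site d) (2 * w + v),
        (∑ j, |((x j : ℝ) - (y j : ℝ))|) ≤ ∑ j, |((x' j : ℝ) - (y j : ℝ))| := fun m y =>
    Finset.exists_min_image _ (fun x => ∑ j, |((x j : ℝ) - (y j : ℝ))|) (hne m)
  choose xs hxs hxmin using hmin
  obtain ⟨ρ, hρdef⟩ : ∃ ρ : ↥B → B1Eq324BenfattoLemma.Site d → ℝ, ∀ m y, ρ m y = ∑ j, |((xs m y j : ℝ) - (y j : ℝ))| :=
    ⟨fun m y => ∑ j, |((xs m y j : ℝ) - (y j : ℝ))|, fun _ _ => rfl⟩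
  have hρle : ∀ m : ↥B, ∀ x ∈ shrink L (m : B1Eq324BenfattoLemma.Site d) (2 * w + v), ∀ y,
      ρ m y ≤ ∑ j, |((x j : ℝ) - (y j : ℝ))| := fun m x hx y => by
    rw [hρdef]
    exact hxmin m y x hx
  have hρex : ∀ m : ↥B, ∀ y ∈ J, ∃ x ∈ shrink L (m : B1Eq324BenfattoLemma.Site d) (2 * w + v),
      (∑ j, |((x j : ℝ) - (y j : ℝ))|) ≤ ρ m y := fun m y _ =>
    ⟨xs m y, hxs m y, by rw [hρdef]⟩
  have hρge : ∀ m : ↥B, ∀ y, ∀ r : ℝ, (∀ x ∈ shrink L (m : B1Eq324BenfattoLemma.Site d) (2 * w + v),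
      r ≤ ∑ j, |((x j : ℝ) - (y j : ℝ))|) → r ≤ ρ m y := fun m y r h => by
    rw [hρdef]
    exact h _ (hxs m y)
  have hc₂ : 0 < δ / (2 * ((k + 1 : ℕ) : ℝ)) := by positivity
  have hcard : ∀ m : ↥B, ((shrink L (m : B1Eq324BenfattoLemma.Site d) (2 * w + v)).card : ℝ) ≤ (L : ℝ) ^ d := fun m => by
    exact_mod_cast card_shrink_le L (m : B1Eq324BenfattoLemma.Site d) (2 * w + v)
  -- the far classes of anchor `m` are anchored at `ρ_m ≥ w+v+1`
  have hfar : ∀ m : ↥B, ∀ c ∈ ((univ : Finset (Option (↥B × Bool))).erase (some (m, false))).erase (some (m, true)),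
      ∀ p (hp : p ∈ Finset.Icc 1 s), ∀ Δ ∈ cls c p,
        (w : ℝ) + v + 1 ≤ ρ m (Δ ⟨0, (Finset.mem_Icc.1 hp).1⟩ : B1Eq324BenfattoLemma.Site d) := by
    intro m c hc p hp Δ hΔ
    have hc1 : c ≠ some (m, true) := Finset.ne_of_mem_erase hc
    have hc2 : c ≠ some (m, false) := Finset.ne_of_mem_erase (Finset.mem_of_mem_erase hc)
    refine hρge m _ _ fun x hx => ?_
    have hx' : x ∈ shrink L (m : B1Eq324BenfattoLemma.Site d) (w + (w + v)) := by
      rw [show w + (w + v) = 2 * w + v by ring]; exact hx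
    rcases c with _ | ⟨m', bb⟩
    · have hy := hnone p Δ hΔ ⟨0, (Finset.mem_Icc.1 hp).1⟩
      have hy' : (Δ ⟨0, (Finset.mem_Icc.1 hp).1⟩ : B1Eq324BenfattoLemma.Site d) ∉ shrink L (m : B1Eq324BenfattoLemma.Site d) w :=
        fun h => Finset.disjoint_left.1 (disjoint_corridors_shrink hL w B (m : B1Eq324BenfattoLemma.Site d)) hy h
      have h := le_l1_of_mem_shrink_of_not_mem_shrink hx' hy'
      push_cast at h ⊢
      linarith
    · have hm' : m' ≠ m := by
        rintro rfl
        cases bb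
        · exact hc2 rfl
        · exact hc1 rfl
      have hne' : (m' : B1Eq324BenfattoLemma.Site d) ≠ (m : B1Eq324BenfattoLemma.Site d) := fun h => hm' (Subtype.ext h)
      have hy := hbox m' bb p Δ hΔ ⟨0, (Finset.mem_Icc.1 hp).1⟩
      have hy' : (Δ ⟨0, (Finset.mem_Icc.1 hp).1⟩ : B1Eq324BenfattoLemma.Site d) ∉ box L (m : B1Eq324BenfattoLemma.Site d) :=
        fun h => Finset.disjoint_left.1 (disjoint_box hL hne') hy h
      have h := le_l1_of_mem_shrink_of_not_mem_box hx hy'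
      push_cast at h ⊢
      linarith
  have hnn : ∀ (m : ↥B) (c : Option (↥B × Bool)), 0 ≤ ∑ p ∈ Finset.Icc 1 s, ∑ Δ ∈ cls c p, ∑ n ∈ admissible p D,
      |a p (fun i => (Δ i : B1Eq324BenfattoLemma.Site d)) n| *
        Real.exp (-(κ / 2) * connLength fun i => (Δ i : B1Eq324BenfattoLemma.Site d)) *
        (Real.exp (δ / 2 * ((D : ℝ) ^ 2 * (Real.sqrt d * connLength (fun i => (Δ i : B1Eq324BenfattoLemma.Site d)) + d))) *
          Real.exp (-(δ / (2 * ((k + 1 : ℕ) : ℝ)) *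
            ρ m (if h : 0 < p then (Δ ⟨0, h⟩ : B1Eq324BenfattoLemma.Site d) else 0)))) := fun m c =>
    Finset.sum_nonneg fun p _ => Finset.sum_nonneg fun Δ _ => Finset.sum_nonneg fun n _ =>
      mul_nonneg (mul_nonneg (abs_nonneg _) (Real.exp_pos _).le) (mul_nonneg (Real.exp_pos _).le (Real.exp_pos _).le)
  have hK₀0 : 0 ≤ K₀ := zero_le_one.trans hK₀
  -- assemble
  have hmain := abs_cross_kernel_le_sum_anchor (s := s) (D := D) (κ := κ) (a := a) hK hdiag hK₀ hdec cls hdeep hδ.le hδle ρ hρle k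
  refine le_trans hmain (mul_le_mul_of_nonneg_left ?_ (by positivity))
  refine (Finset.sum_le_sum fun m _ => crossAssemble (by positivity) (Finset.sum_nonneg fun c _ => hnn m c)
    (Finset.sum_nonneg fun c _ => hnn m c) ((hnn m none).trans (oneClass_le hres hc₂ hA0 hA (cls none) _ (hcard m) (ρ m) (hρex m)))
    (oneClass_le hres hc₂ hA0 hA (cls (some (m, true))) _ (hcard m) (ρ m) (hρex m))
    (family_far_le hres hc₂ hA0 hA _ cls (fun p c₁ _ c₂' _ hne' => hdisj p c₁ c₂' hne') _ (hcard m) (ρ m) (hρex m) (hfar m))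
    (family_all_le hres hc₂ hA0 hA cls hdisj _ (hcard m) (ρ m) (hρex m))).trans (le_of_eq ?_)
  rw [Finset.sum_const, nsmul_eq_mul, Finset.card_univ, Fintype.card_coe]

end Cross

end Literature.MathematicalPhysics.QuantumFieldTheory.Balaban1983to89.B1Eq324BenfattoKernelSect5FreeStepCross
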